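import Summits.Schanuel.Schanuel.Theorems.RootDecomp1BMovingZero11

/-!
# RootDecomp1BMovingZero — lens 4, generation 36 «AX-TRANSVERSAL MOVING ZERO»: SUB-PIECE B = the ARITHMETIC of the moved zero (ONE print fact `IsolatedPointBound` = KPS 2001 Cor. 2.10 + PINNING + q-bookkeeping PROVED) ⟹ `ApproxOfIsolated ρ` and `MovingZeroApprox ρ` for EVERY real ρ — continuation (RootDecomp1BMovingZero12): B-2 PINNING `isolated_pt` + B-3 q-BOOKKEEPING

(lens-4 g36 HOME kernel MovingZeroPieceB.lean 579d1afa…, 819 l, import = tree RootDecomp1BMovingZero10 only; NOTE/CLAIM L1871, critic ACK L1875 (B design no objection; typing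
requirements B1–B6), NODE L1891 / REQUEST L1892 / RESULT L1893, critic VERDICT L1894 (CLEARED · B-FACT ACCEPTED (B1–B6 all pass; fact budget T 1 · A 2 · B 1 = 4/4 USED) · the RESERVED CELL CREDIT B-R22 (a) AWARDED to lens-4 · PORT GO); port by census-1 gen 17 as `RootDecomp1BMovingZero11`–`13`: 11 = §B the B-FACT
`IsolatedPointBound` ((s, n)-general, Euclidean isolation ⟹ per-coordinate irreducible integer polynomial of degree ≤ Π Dᵢ and log-Mahler-measure ≤ (Π Dᵢ)(n log H +
(2n+3) log(n+1)); corollary-composite of KPS 2001 Cor. 2.10 [KrickPardoSombra2001] + Bézout [Heintz1983] + [Chirka1989 §3.5]; named def, `--no-relocate`) + non-vacuity +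
B-1 the five integer equations `sys` in 𝔸⁵ and the lifted point `pt`; 12 = B-2 PINNING `isolated_pt` (isolation in all five coordinates) + B-3 q-BOOKKEEPING; 13 = B-4
`approxOfIsolated_of_facts : AnalyticMovingZero → IsolatedPointBound → ∀ ρ, ApproxOfIsolated ρ`, `movingZeroApprox_of_facts` + §B-5 CELL CLOSURE
`movingZeroApprox_of_all_facts : CurveSelection → AxRankBoundLaurent → RoucheMaps → IsolatedZeroLowerBound → IsolatedPointBound → ∀ ρ, MovingZeroApprox ρ`,
`four_le_polarDeg_one_of_all_facts`, `…_rhoT_…`. PORT EDITS: the `AxiomGuards` section (8 `#guard_msgs in #print axioms`) and `set_option linter.dupNamespace false` dropped;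
ten one-line docstrings (`pt_*`, `sys_*`); statements and proofs verbatim. `--supports stmt-Schanuel-32406`; no census credit carried; rung 0 — nothing here proves Schanuel.)
-/

noncomputable section

open Complex Polynomial

namespace Summit.Schanuel.Schanuel.Theorems.RootDecomp1BMovingZero

section PieceBPinning

open Filter Topology

/-- Equation `0` of the system is the linear pin `qT − p`. -/
@[simp] theorem sys_zero {K₁ K₂ : ℕ} (G₁ : Fin (K₁ + 1) → MvPolynomial (Fin 3) ℤ)
    (G₂ : Fin (K₂ + 1) → MvPolynomial (Fin 3) ℤ) (r : ℚ) : sys G₁ G₂ r 0 = linPoly r.den r.num := rfl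
/-- Equation `1` of the system is the first relation polynomial in `U`. -/
@[simp] theorem sys_one {K₁ K₂ : ℕ} (G₁ : Fin (K₁ + 1) → MvPolynomial (Fin 3) ℤ)
    (G₂ : Fin (K₂ + 1) → MvPolynomial (Fin 3) ℤ) (r : ℚ) : sys G₁ G₂ r 1 = relPoly G₁ 3 := rfl
/-- Equation `2` of the system is the second relation polynomial in `V`. -/
@[simp] theorem sys_two {K₁ K₂ : ℕ} (G₁ : Fin (K₁ + 1) → MvPolynomial (Fin 3) ℤ)
    (G₂ : Fin (K₂ + 1) → MvPolynomial (Fin 3) ℤ) (r : ℚ) : sys G₁ G₂ r 2 = relPoly G₂ 4 := rfl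
/-- Equation `3` of the system is the branch binomial for `(X, U)`. -/
@[simp] theorem sys_three {K₁ K₂ : ℕ} (G₁ : Fin (K₁ + 1) → MvPolynomial (Fin 3) ℤ)
    (G₂ : Fin (K₂ + 1) → MvPolynomial (Fin 3) ℤ) (r : ℚ) : sys G₁ G₂ r 3 = powPoly r.den r.num 1 3 := rfl
/-- Equation `4` of the system is the branch binomial for `(Y, V)`. -/
@[simp] theorem sys_four {K₁ K₂ : ℕ} (G₁ : Fin (K₁ + 1) → MvPolynomial (Fin 3) ℤ)
    (G₂ : Fin (K₂ + 1) → MvPolynomial (Fin 3) ℤ) (r : ℚ) : sys G₁ G₂ r 4 = powPoly r.den r.num 2 4 := rfl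

/-! ### B-2  PINNING (s-iii, PROVED): the lifted point of an isolated zero of the `r`-curves is an ISOLATED point
of the complex zero set of `E(r)` — by the `q`-th-root-of-unity gap and continuity of the principal branch. -/

/-- ROOT-OF-UNITY GAP (existence form): near `1`, the only `q`-th root of unity is `1` (`q ≥ 1`). -/
theorem eventually_pow_eq_one_imp {q : ℕ} (hq : 0 < q) :
    ∀ᶠ ζ in 𝓝 (1 : ℂ), ζ ^ q = 1 → ζ = 1 := by
  have hfin : {ζ : ℂ | ζ ^ q = 1 ∧ ζ ≠ 1}.Finite := by
    refine (Polynomial.nthRoots q (1 : ℂ)).toFinset.finite_toSet.subset ?_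
    intro ζ hζ
    simp only [Set.mem_setOf_eq] at hζ
    simp only [Finset.mem_coe, Multiset.mem_toFinset, Polynomial.mem_nthRoots hq]
    exact hζ.1
  have hopen : IsOpen {ζ : ℂ | ζ ^ q = 1 ∧ ζ ≠ 1}ᶜ := hfin.isClosed.isOpen_compl
  have hmem : (1 : ℂ) ∈ {ζ : ℂ | ζ ^ q = 1 ∧ ζ ≠ 1}ᶜ := fun h => h.2 rfl
  filter_upwards [hopen.mem_nhds hmem] with ζ hζ hpow
  by_contra hne
  exact hζ ⟨hpow, hne⟩

/-- The branch ratio `ω ↦ ω_u / e^{r log ω_x}` is continuous where `ω_x` is off the cut. -/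
theorem continuousAt_branchRatio (r : ℚ) (x u : Fin 5) {ω : Fin 5 → ℂ} (hx : ω x ∈ Complex.slitPlane) :
    ContinuousAt (fun ω' : Fin 5 → ℂ => ω' u / cexp ((r : ℂ) * Complex.log (ω' x))) ω := by
  refine (continuous_apply u).continuousAt.div ?_ (Complex.exp_ne_zero _)
  have hlog : ContinuousAt (fun ω' : Fin 5 → ℂ => Complex.log (ω' x)) ω :=
    ContinuousAt.clog (f := fun ω' : Fin 5 → ℂ => ω' x) (x := ω) (continuous_apply x).continuousAt hx
  exact (continuousAt_const.mul hlog).cexp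

/-- From `U^q · X^{p⁻} = X^{p⁺}` (`X ≠ 0`): the branch ratio `U / e^{r log X}` is a `q`-th root of unity. -/
theorem branchRatio_pow_eq_one {r : ℚ} {X U : ℂ} (hX : X ≠ 0)
    (h : U ^ r.den * X ^ (-r.num).toNat - X ^ r.num.toNat = 0) :
    (U / cexp ((r : ℂ) * Complex.log X)) ^ r.den = 1 := by
  have hE : cexp ((r : ℂ) * Complex.log X) ≠ 0 := Complex.exp_ne_zero _
  have h1 := cexp_mul_log_pow_den (r := r) hX
  have hXp : X ^ (-r.num).toNat ≠ 0 := pow_ne_zero _ hX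
  have h2 : U ^ r.den = cexp ((r : ℂ) * Complex.log X) ^ r.den := by
    apply mul_right_cancel₀ hXp
    rw [h1]
    exact sub_eq_zero.mp h
  rw [div_pow, h2, div_self (pow_ne_zero _ hE)]

/-- **PINNING.**  If `w = (X, Y)` (both off the cut) is an isolated zero of the `r`-curves, then
`ω(r, w) = (r, X, Y, e^{r log X}, e^{r log Y})` is an isolated point of the complex zero set of `E(r)`. -/
theorem isolated_pt {K₁ K₂ : ℕ} (G₁ : Fin (K₁ + 1) → MvPolynomial (Fin 3) ℤ)
    (G₂ : Fin (K₂ + 1) → MvPolynomial (Fin 3) ℤ) (r : ℚ) {w : ℂ × ℂ} (hX : w.1 ∈ Complex.slitPlane)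
    (hY : w.2 ∈ Complex.slitPlane) (hiso : ∀ᶠ w' in 𝓝[≠] w, curveΦ G₁ G₂ r w' ≠ 0) :
    ∀ᶠ ω in 𝓝[≠] (pt r w), ∃ i, MvPolynomial.aeval ω (sys G₁ G₂ r i) ≠ 0 := by
  have hq : 0 < r.den := r.den_pos
  -- (1) near `pt`, the only zero of the `r`-curves is `w`
  have h1 : ∀ᶠ ω in 𝓝 (pt r w), (ω 1, ω 2) ≠ w → curveΦ G₁ G₂ r (ω 1, ω 2) ≠ 0 := by
    have hc : Continuous (fun ω : Fin 5 → ℂ => (ω 1, ω 2)) := (continuous_apply 1).prodMk (continuous_apply 2)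
    have ht : Tendsto (fun ω : Fin 5 → ℂ => (ω 1, ω 2)) (𝓝 (pt r w)) (𝓝 w) := by
      have hval : (fun ω : Fin 5 → ℂ => (ω 1, ω 2)) (pt r w) = w := Prod.ext rfl rfl
      rw [← hval]
      exact hc.continuousAt
    exact ht.eventually (eventually_nhdsWithin_iff.mp hiso)
  -- (2) near `pt`, `ω 1` and `ω 2` stay off the cut
  have h2 : ∀ᶠ ω in 𝓝 (pt r w), ω 1 ∈ Complex.slitPlane :=
    (continuous_apply 1).continuousAt.eventually_mem (Complex.isOpen_slitPlane.mem_nhds hX)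
  have h3 : ∀ᶠ ω in 𝓝 (pt r w), ω 2 ∈ Complex.slitPlane :=
    (continuous_apply 2).continuousAt.eventually_mem (Complex.isOpen_slitPlane.mem_nhds hY)
  -- (3) near `pt`, a branch ratio which is a `q`-th root of unity IS `1`
  have h4 : ∀ᶠ ω in 𝓝 (pt r w), (ω 3 / cexp ((r : ℂ) * Complex.log (ω 1))) ^ r.den = 1 →
      ω 3 / cexp ((r : ℂ) * Complex.log (ω 1)) = 1 := by
    have hc := continuousAt_branchRatio r 1 3 (ω := pt r w) hX
    have hval : (fun ω' : Fin 5 → ℂ => ω' 3 / cexp ((r : ℂ) * Complex.log (ω' 1))) (pt r w) = 1 :=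
      div_self (Complex.exp_ne_zero _)
    have ht : Tendsto (fun ω' : Fin 5 → ℂ => ω' 3 / cexp ((r : ℂ) * Complex.log (ω' 1))) (𝓝 (pt r w)) (𝓝 1) := by
      rw [← hval]; exact hc
    exact ht.eventually (eventually_pow_eq_one_imp hq)
  have h5 : ∀ᶠ ω in 𝓝 (pt r w), (ω 4 / cexp ((r : ℂ) * Complex.log (ω 2))) ^ r.den = 1 →
      ω 4 / cexp ((r : ℂ) * Complex.log (ω 2)) = 1 := by
    have hc := continuousAt_branchRatio r 2 4 (ω := pt r w) hY
    have hval : (fun ω' : Fin 5 → ℂ => ω' 4 / cexp ((r : ℂ) * Complex.log (ω' 2))) (pt r w) = 1 :=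
      div_self (Complex.exp_ne_zero _)
    have ht : Tendsto (fun ω' : Fin 5 → ℂ => ω' 4 / cexp ((r : ℂ) * Complex.log (ω' 2))) (𝓝 (pt r w)) (𝓝 1) := by
      rw [← hval]; exact hc
    exact ht.eventually (eventually_pow_eq_one_imp hq)
  -- combine
  filter_upwards [eventually_nhdsWithin_of_eventually_nhds h1, eventually_nhdsWithin_of_eventually_nhds h2,
    eventually_nhdsWithin_of_eventually_nhds h3, eventually_nhdsWithin_of_eventually_nhds h4,
    eventually_nhdsWithin_of_eventually_nhds h5, self_mem_nhdsWithin] with ω e1 e2 e3 e4 e5 hne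
  by_contra hall
  push Not at hall
  have hX0 : ω 1 ≠ 0 := Complex.slitPlane_ne_zero e2
  have hY0 : ω 2 ≠ 0 := Complex.slitPlane_ne_zero e3
  -- `T = r`
  have hT : ω 0 = (r : ℂ) := by
    have h := hall 0
    rw [sys_zero, aeval_linPoly, sub_eq_zero] at h
    have hq' : (r.den : ℂ) ≠ 0 := Nat.cast_ne_zero.mpr hq.ne'
    apply mul_left_cancel₀ hq'
    rw [h, den_mul_cast_eq_num]
  -- `U = e^{r log X}`, `V = e^{r log Y}`
  have hU : ω 3 = cexp ((r : ℂ) * Complex.log (ω 1)) := by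
    have h := hall 3
    rw [sys_three, aeval_powPoly] at h
    have h' := e4 (branchRatio_pow_eq_one hX0 h)
    rwa [div_eq_one_iff_eq (Complex.exp_ne_zero _)] at h'
  have hV : ω 4 = cexp ((r : ℂ) * Complex.log (ω 2)) := by
    have h := hall 4
    rw [sys_four, aeval_powPoly] at h
    have h' := e5 (branchRatio_pow_eq_one hY0 h)
    rwa [div_eq_one_iff_eq (Complex.exp_ne_zero _)] at h'
  -- `(X, Y)` is a zero of the `r`-curves, hence `= w`
  have hzero : curveΦ G₁ G₂ r (ω 1, ω 2) = 0 := by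
    have h₁ := hall 1
    have h₂ := hall 2
    rw [sys_one, aeval_relPoly, hT, hU] at h₁
    rw [sys_two, aeval_relPoly, hT, hV] at h₂
    simp only [curveΦ, Prod.mk_eq_zero]
    exact ⟨h₁, h₂⟩
  have hw : (ω 1, ω 2) = w := by
    by_contra hne'
    exact e1 hne' hzero
  have hw1 : ω 1 = w.1 := congrArg Prod.fst hw
  have hw2 : ω 2 = w.2 := congrArg Prod.snd hw
  apply hne
  funext i
  fin_cases i
  · exact hT
  · exact hw1
  · exact hw2
  · simp only [Fin.reduceFinMk, pt_three]
    rw [hU, hw1]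
  · simp only [Fin.reduceFinMk, pt_four]
    rw [hV, hw2]

end PieceBPinning

section PieceBBookkeeping

open Filter Topology

/-! ### B-3  q-BOOKKEEPING (PROVED): degrees and coefficients of `E(r)`; the slit-plane ball at `θ`; smallness of
`C s^κ`; the threshold `q₀`; `|p| ≤ (|ρ|+1) q`. -/

/-- Every integer polynomial has its coefficients bounded in absolute value by a natural number. -/
theorem exists_coeff_abs_le {σ : Type*} (φ : MvPolynomial σ ℤ) : ∃ H : ℕ, ∀ m, |φ.coeff m| ≤ (H : ℤ) := by
  classical
  refine ⟨∑ m ∈ φ.support, (φ.coeff m).natAbs, fun m => ?_⟩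
  by_cases hm : m ∈ φ.support
  · rw [Nat.cast_sum]
    calc |φ.coeff m| = ((φ.coeff m).natAbs : ℤ) := (Int.natCast_natAbs _).symm
      _ ≤ ∑ m' ∈ φ.support, ((φ.coeff m').natAbs : ℤ) :=
          Finset.single_le_sum (f := fun m' => ((φ.coeff m').natAbs : ℤ)) (fun _ _ => by positivity) hm
  · rw [MvPolynomial.notMem_support_iff.mp hm, abs_zero]
    positivity

/-- `deg E₀ ≤ 1`. -/
theorem totalDegree_linPoly (q : ℕ) (p : ℤ) : (linPoly q p).totalDegree ≤ 1 := by
  unfold linPoly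
  refine (MvPolynomial.totalDegree_sub _ _).trans (max_le ?_ ?_)
  · refine (MvPolynomial.totalDegree_mul _ _).trans ?_
    rw [MvPolynomial.totalDegree_C, MvPolynomial.totalDegree_X, zero_add]
  · rw [MvPolynomial.totalDegree_C]
    exact Nat.zero_le _

/-- `|coeff E₀| ≤ q + |p|`. -/
theorem coeff_linPoly_abs_le (q : ℕ) (p : ℤ) (m : Fin 5 →₀ ℕ) :
    |(linPoly q p).coeff m| ≤ (q : ℤ) + |p| := by
  classical
  have key : ∀ a b : ℤ, |a| ≤ 1 → |b| ≤ |p| → |(q : ℤ) * a - b| ≤ (q : ℤ) + |p| := by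
    intro a b ha hb
    calc |(q : ℤ) * a - b| ≤ |(q : ℤ) * a| + |b| := abs_sub _ _
      _ = (q : ℤ) * |a| + |b| := by rw [abs_mul, Nat.abs_cast]
      _ ≤ (q : ℤ) * 1 + |p| := by gcongr
      _ = (q : ℤ) + |p| := by ring
  unfold linPoly
  rw [MvPolynomial.coeff_sub, MvPolynomial.coeff_C_mul, MvPolynomial.coeff_X, MvPolynomial.coeff_C]
  split_ifs <;> apply key <;> simp

/-- `deg E₃, deg E₄ ≤ q + |p|`. -/
theorem totalDegree_powPoly (q : ℕ) (p : ℤ) (x u : Fin 5) : (powPoly q p x u).totalDegree ≤ q + p.natAbs := by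
  unfold powPoly
  have hp := Int.toNat_add_toNat_neg_eq_natAbs p
  refine (MvPolynomial.totalDegree_sub _ _).trans (max_le ?_ ?_)
  · refine (MvPolynomial.totalDegree_mul _ _).trans ?_
    rw [MvPolynomial.totalDegree_X_pow, MvPolynomial.totalDegree_X_pow]
    omega
  · rw [MvPolynomial.totalDegree_X_pow]
    omega

/-- `|coeff E₃|, |coeff E₄| ≤ 2` (they are differences of two monic monomials). -/
theorem coeff_powPoly_abs_le (q : ℕ) (p : ℤ) (x u : Fin 5) (m : Fin 5 →₀ ℕ) :
    |(powPoly q p x u).coeff m| ≤ 2 := by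
  classical
  unfold powPoly
  rw [MvPolynomial.X_pow_eq_monomial, MvPolynomial.X_pow_eq_monomial, MvPolynomial.X_pow_eq_monomial,
    MvPolynomial.monomial_mul, MvPolynomial.coeff_sub, MvPolynomial.coeff_monomial, MvPolynomial.coeff_monomial]
  split_ifs <;> simp

/-- A ball around `θ = (e, e^i)` inside `slitPlane × slitPlane`. -/
theorem exists_ball_theta_slit : ∃ η : ℝ, 0 < η ∧ ∀ w : ℂ × ℂ, ‖w - (cexp 1, cexp Complex.I)‖ < η →
    w.1 ∈ Complex.slitPlane ∧ w.2 ∈ Complex.slitPlane := by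
  have hopen : IsOpen {w : ℂ × ℂ | w.1 ∈ Complex.slitPlane ∧ w.2 ∈ Complex.slitPlane} :=
    (Complex.isOpen_slitPlane.preimage continuous_fst).inter (Complex.isOpen_slitPlane.preimage continuous_snd)
  have hmem : (cexp 1, cexp Complex.I) ∈ {w : ℂ × ℂ | w.1 ∈ Complex.slitPlane ∧ w.2 ∈ Complex.slitPlane} :=
    ⟨exp_one_mem_slitPlane, exp_I_mem_slitPlane⟩
  obtain ⟨η, hη, hsub⟩ := Metric.isOpen_iff.mp hopen _ hmem
  refine ⟨η, hη, fun w hw => hsub ?_⟩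
  rwa [Metric.mem_ball, dist_eq_norm]

/-- Smallness: `C s^κ < η` for `0 ≤ s < δ` (`κ > 0`). -/
theorem exists_delta_rpow_lt (C : ℝ) {κ η : ℝ} (hκ : 0 < κ) (hη : 0 < η) :
    ∃ δ : ℝ, 0 < δ ∧ ∀ s : ℝ, 0 ≤ s → s < δ → C * s ^ κ < η := by
  have hcont : ContinuousAt (fun s : ℝ => C * s ^ κ) 0 :=
    continuousAt_const.mul (Real.continuousAt_rpow_const 0 κ (Or.inr hκ.le))
  have hval : (fun s : ℝ => C * s ^ κ) 0 < η := by
    simp only [Real.zero_rpow hκ.ne', mul_zero]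
    exact hη
  have hev : ∀ᶠ s in 𝓝 (0 : ℝ), C * s ^ κ < η := Filter.Tendsto.eventually hcont (gt_mem_nhds hval)
  obtain ⟨δ, hδ, h⟩ := Metric.eventually_nhds_iff.mp hev
  refine ⟨δ, hδ, fun s hs0 hs => h ?_⟩
  rwa [dist_zero_right, Real.norm_eq_abs, abs_of_nonneg hs0]

/-- The threshold `q₀`: `e^{−q} < ε` for all `q ≥ q₀`. -/
theorem exists_nat_exp_neg_lt {ε : ℝ} (hε : 0 < ε) : ∃ q₀ : ℕ, ∀ q : ℕ, q₀ ≤ q → Real.exp (-(q : ℝ)) < ε := by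
  have ht : Tendsto (fun q : ℕ => Real.exp (-(q : ℝ))) atTop (𝓝 0) :=
    Real.tendsto_exp_neg_atTop_nhds_zero.comp tendsto_natCast_atTop_atTop
  obtain ⟨q₀, h⟩ := Filter.eventually_atTop.mp (ht.eventually (gt_mem_nhds hε))
  exact ⟨q₀, h⟩

/-- `p = r · q` for `r = p/q` in lowest terms (as reals). -/
theorem num_eq_mul_den (r : ℚ) : (r.num : ℝ) = (r : ℝ) * (r.den : ℝ) := by
  have h := Rat.mul_den_eq_num r
  exact_mod_cast h.symm

/-- `|p| ≤ (|ρ| + 1) q` once `|ρ − p/q| < 1`; typed as `q + |p| ≤ (|ρ| + 2) q`. -/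
theorem den_add_natAbs_num_le {ρ : ℝ} {r : ℚ} (h : |ρ - r| < 1) :
    ((r.den + r.num.natAbs : ℕ) : ℝ) ≤ (|ρ| + 2) * r.den := by
  have hqpos : (0 : ℝ) < r.den := Nat.cast_pos.mpr r.den_pos
  have hrabs : |(r : ℝ)| ≤ |ρ| + 1 := by
    have h1 := abs_sub_abs_le_abs_sub (r : ℝ) ρ
    rw [abs_sub_comm] at h1
    linarith
  have hpabs : |(r.num : ℝ)| ≤ (|ρ| + 1) * r.den := by
    rw [num_eq_mul_den, abs_mul, Nat.abs_cast]
    exact mul_le_mul_of_nonneg_right hrabs hqpos.le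
  rw [Nat.cast_add, Nat.cast_natAbs, Int.cast_abs]
  linarith

end PieceBBookkeeping

end Summit.Schanuel.Schanuel.Theorems.RootDecomp1BMovingZero

end
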